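import Literature.Probability.LatticeModels.RandomClusterRayleighSeriesParallel
import HarnessLib

/-!
# `K₄`-minor-free graphs are partial 2-trees — file 1: definitions (path sequences, rotation, segments, vertex deletion)

Support file (`--supports stmt-CriticalPhenomena-4575`), FK sub-lane `prim-bschramm-fk-3` (gen 6) of the post-continuity
programme; builds on p205010 (kernel theorem, internal audit signed; external expert review pending).  Pure graph theory, no
named facts, no sorries; standard axioms.  PURPOSE: the discharge of the named fact `Wagner2008_rc_edgeNegCorr_of_noK4Minor`
(Wagner 2008, graph case; `Literature/Probability/LatticeModels/RandomClusterRayleighSeriesParallel.lean`) needs the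
classical STRUCTURE THEOREM "a finite graph without a `K₄` minor is a subgraph of a 2-tree" (Dirac 1952 / Duffin 1965 /
Wald–Colbourn 1983; Diestel, Graph Theory, §7.3), so that fk-1's kernel theorem `FK.rc_edgeNegCorr_of_isTwoTree` (negative edge correlation of
`φ_{w,q}`, `0 < q ≤ 1`, on 2-tree supports) applies to every `K₄`-minor-free support.

This file: the (few) definitions used by the proof, with their unfolding lemmas —
* `K4Free.IsPathSeq G f m` — `f 0, …, f m` is a path (consecutive adjacent, pairwise distinct); `K4Free.IsLongest`;
* `K4Free.rot f i` — the Pósa rotation (reverse the prefix `f 0 … f (i-1)`); `K4Free.seg f lo hi = f '' [lo, hi]`;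
* `K4Free.delVert G v` — `G` with the edges at `v` deleted; `K4Free.ThreeNeighbours G` — every non-isolated vertex has three
  distinct neighbours; `K4Free.hasK4Minor_of_le` — monotonicity of `HasK4Minor` (branch sets).
The theorems are in `…K4MinorFreePaths.lean` (longest paths, rotation, `K₄` minors from path segments) and
`…K4MinorFreeDirac.lean` (Dirac's lemma, suppression of degree-two vertices, embedding into a 2-tree).
[cite: Diestel2017, §7.3 (Prop. 7.3.1, Cor. 7.3.2); §1.7 (minors)] [cite: Wagner2006, §5.3]
-/

namespace Summit.CriticalPhenomena.PercolationContinuityZ3.Theorems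

namespace K4Free

open Literature.Probability.LatticeModels (HasK4Minor)

variable {V : Type*}

/-! ### Definitions -/

/-- A path of length `m` in `G` presented as a sequence: `f 0, …, f m` are pairwise distinct and consecutive
terms are adjacent (values of `f` beyond `m` are irrelevant). [folklore] -/
structure IsPathSeq (G : SimpleGraph V) (f : ℕ → V) (m : ℕ) : Prop where
  /-- consecutive vertices are adjacent -/
  adj : ∀ t, t < m → G.Adj (f t) (f (t + 1))
  /-- the vertices are pairwise distinct -/
  inj : ∀ s t, s ≤ m → t ≤ m → f s = f t → s = t

/-- A longest path of `G`: a path sequence of length `m` such that no path sequence is longer. [folklore] -/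
def IsLongest (G : SimpleGraph V) (f : ℕ → V) (m : ℕ) : Prop :=
  IsPathSeq G f m ∧ ∀ (f' : ℕ → V) (m' : ℕ), IsPathSeq G f' m' → m' ≤ m

/-- The Pósa rotation of a path sequence at index `i`: reverse the initial segment `f 0, …, f (i-1)` and keep
the rest, `f (i-1), f (i-2), …, f 0, f i, f (i+1), …`. [folklore] -/
def rot (f : ℕ → V) (i : ℕ) : ℕ → V := fun t => if t < i then f (i - 1 - t) else f t

/-- The segment `{f lo, …, f hi}` of a sequence. [folklore] -/
def seg (f : ℕ → V) (lo hi : ℕ) : Set V := f '' Set.Icc lo hi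

/-- The graph obtained from `G` by deleting every edge at the vertex `v`. [folklore] -/
def delVert (G : SimpleGraph V) (v : V) : SimpleGraph V where
  Adj a b := G.Adj a b ∧ a ≠ v ∧ b ≠ v
  symm := ⟨fun _ _ h => ⟨h.1.symm, h.2.2, h.2.1⟩⟩
  loopless := ⟨fun _ h => h.1.ne rfl⟩

/-! ### Basic API -/

variable {G : SimpleGraph V}

/-- `rot f i t = f (i - 1 - t)` on the reversed prefix. [folklore] -/
theorem rot_of_lt {f : ℕ → V} {i t : ℕ} (h : t < i) : rot f i t = f (i - 1 - t) := if_pos h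

/-- `rot f i t = f t` beyond the prefix. [folklore] -/
theorem rot_of_le {f : ℕ → V} {i t : ℕ} (h : i ≤ t) : rot f i t = f t := if_neg (Nat.not_lt.2 h)

/-- The rotated path starts at `f (i - 1)`. [folklore] -/
theorem rot_zero {f : ℕ → V} {i : ℕ} (h : 1 ≤ i) : rot f i 0 = f (i - 1) := by
  rw [rot_of_lt (by omega), Nat.sub_zero]

/-- Membership in a segment. [folklore] -/
theorem mem_seg {f : ℕ → V} {lo hi t : ℕ} (h1 : lo ≤ t) (h2 : t ≤ hi) : f t ∈ seg f lo hi :=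
  ⟨t, ⟨h1, h2⟩, rfl⟩

/-- Unfolding membership in a segment. [folklore] -/
theorem mem_seg_iff {f : ℕ → V} {lo hi : ℕ} {x : V} : x ∈ seg f lo hi ↔ ∃ t, lo ≤ t ∧ t ≤ hi ∧ f t = x := by
  constructor
  · rintro ⟨t, ⟨h1, h2⟩, rfl⟩; exact ⟨t, h1, h2, rfl⟩
  · rintro ⟨t, h1, h2, rfl⟩; exact ⟨t, ⟨h1, h2⟩, rfl⟩

/-- `delVert G v` is a subgraph of `G`. [folklore] -/
theorem delVert_le (G : SimpleGraph V) (v : V) : delVert G v ≤ G := fun _ _ h => h.1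

/-- Adjacency in `delVert`. [folklore] -/
theorem delVert_adj {G : SimpleGraph V} {v a b : V} : (delVert G v).Adj a b ↔ G.Adj a b ∧ a ≠ v ∧ b ≠ v := Iff.rfl

/-- A `K₄` minor of a subgraph is a `K₄` minor of the graph. [folklore] -/
theorem hasK4Minor_of_le {G G' : SimpleGraph V} (h : G ≤ G') (hG : HasK4Minor G) : HasK4Minor G' := by
  obtain ⟨B, hne, hconn, hdisj, hadj⟩ := hG
  refine ⟨B, hne, fun i => (hconn i).mono fun a b hab => h hab, hdisj, fun i j hij => ?_⟩
  obtain ⟨a, ha, b, hb, hab⟩ := hadj i j hij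
  exact ⟨a, ha, b, hb, h hab⟩

/-- Local richness hypothesis: every non-isolated vertex has three distinct neighbours. [folklore] -/
def ThreeNeighbours (G : SimpleGraph V) : Prop :=
  ∀ v : V, (∃ w, G.Adj v w) → ∃ a b c, G.Adj v a ∧ G.Adj v b ∧ G.Adj v c ∧ a ≠ b ∧ a ≠ c ∧ b ≠ c

end K4Free

end Summit.CriticalPhenomena.PercolationContinuityZ3.Theorems
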